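import Summits.QuantumFields.YangMills.Theorems.IR.AfPincerUcTypChainDeep
import HarnessLib

/-!
# Crux `IR` (stmt-QuantumFields-19354), line `af-pincer-Uc`: the CLUSTER-COUNT class `TypCluster` (1/2) — walls read at EVERY scale
# by COUNT, not by extent: no `θ`-bad walk through more than `k` own plaquettes; bookkeeping, `⊆ TypChain`, insertion tolerance
# (seat ym-19354-afpincer-s1 g5; sequel `AfPincerUcTypClusterReduced`: Peierls engine, (iii) proved, (ii) reduced, suppliers, FREE re-cut)

Helper module for item `stmt-QuantumFields-19354` (`--supports stmt-QuantumFields-19354 --as helper`; it closes nothing; registry and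
slot of record «sharp merge I♯_SC» `Cruxes/IR/Lines/af_pincer_Uc_sharp.lean` sha16 `28967a1bf60ad397` UNTOUCHED).

WHY.  The refuter lineage ym-19354-disprove-1 typed the clause-(i) price of BOTH lane-A classes (modulo film wires it does not prove):
`TypChainDeep` does not read the boundary layers where designed films live (GEN 12, p562545: «re-cut by depth for (ii) ONLY IF the outer
layers' walls stay read for (i)»), and the class of record `TypChain ρ θ w ℓ₀` reads walls ONLY AT THE SCALE `ℓ₀` — every patchwork of rough
data below it is admitted (GEN 13, `boxConfig_mem_typChain`), while clause (ii) pins `ℓ₀ = extentOf θ κ C` (hundreds of lattice units).  Located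
reading of this seat: EXTENT is the wrong currency for the wall-reading; the Peierls cost of a bad structure is its NUMBER of bad plaquettes,
and the (ii)/(iii) floor at meshes `b ≤ B e^{Cβ}` is a COUNT `k + 1 > 4C⁺/κ` (`halfExtent κ C`).  THIS FILE types the class reading walls by count:
* §1 `edgeStar`, `card_plaquettesTouching_le_six_mul` — the sharp touching count `#plaquettesTouching P ≤ 6 · #P` in `ℤ⁴` (tree: `30 · #P`).
* §2 `HasBadClusterAmong ρ θ Pl k U`: a `θ`-bad WALK of at most `2k` steps (`ℓ∞`-steps `≤ 2`, repetitions allowed) among the plaquettes of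
  `Pl` VISITING AT LEAST `k + 1` DISTINCT plaquettes (by depth-first traversal of a spanning tree the same as «a `2`-step-connected family of
  `≥ k + 1` `θ`-bad plaquettes of `Pl`»: every connected rough patch, wall, film or chain of more than `k` bad plaquettes, at ANY scale; the walk
  form carries its own Peierls count, `exists_chainFinset`).  **`TypCluster ρ θ w k c := {U | ¬ HasBadClusterAmong ρ θ (cellPlaqs w c) k U}`**;
  `.mono/.congr/.mono_set`, `hasBadClusterAmong_of_injective`, `typCluster_mono` (in `θ`), `one_mem_typCluster`, `mem_typCluster_of_forall_lt`,
  **`not_mem_typCluster_of_injective`** (WHAT THE RE-CUT BUYS, by format: every configuration with an injective `θ`-bad chain of `k + 1` own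
  plaquettes — a wall line, film or rough patch threading `k + 1` bad plaquettes, WHATEVER ITS EXTENT OR DEPTH — is excluded, while `TypChain θ ℓ₀`
  admits all of them below extent `ℓ₀` and `TypChainDeep` all of them in the boundary layers; still admitted: connected bad families of `≤ k`
  plaquettes — sparse dust, cf. disprove-1 GEN 13's dust census j289201/j289202/j289334, `59/59` designs with ONE zero-temperature surface state).
* §3 **`typCluster_subset_typChain`** (`2k ≤ ℓ₀ + 1`; loop erasure `exists_injective_chain`), `typCluster_subset_typChainDeep`; so clause (i) for
  `TypCluster` is IMPLIED by clause (i) for the class of record (`clauseIAll_anti_typ`, `clauseIAll_typCluster_of_typChain`).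
* §4 `TypLocal`: `noClusterAmong_dependsOn`, `measurableSet_noClusterAmong` (any sub-family of the cell), `typLocal_typCluster`.
* §5 R109 (3), own guard, SHARP COUNT: `insertionTolerantOwn_noClusterAmong` (`θg < θb`, `R ≥ 3`, `6ℓ₁ ≤ k`, any sub-family `Pl c ⊆ cellPlaqs w c`),
  `insertionTolerant{Own,}_typCluster`, record `insertionTolerant_typCluster_record` (`ℓ₁ = 6, R = 3, k ≥ 36`).
The sequel shows the re-cut is FREE for the supplier (`TypChainReducedAtSC → TypClusterReducedAtSC`, `k = extentOf θ κ C / 2`).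

NOT done here: clause (i) for collars typical in the cluster sense (weak-coupling mixing — the crux content, unchanged in kind), the kernel
sparseness of the sequel, and whether connected rough patches of `≤ k` plaquettes at the Peierls floor `k ≍ 4C⁺/κ` carry film order
(disprove-1's patch census j289361).  HONEST FRAMING: a typed class and its bookkeeping around ONE open stub of a CONDITIONAL chain (Track A
0/28 UV); nothing of weak-coupling mixing, asymptotic freedom or a gap is proved or claimed; not infinite volume, not Clay.  No `sorry`;
axioms ⊆ {propext, Classical.choice, Quot.sound}; no instances, no notation.  References: R. Peierls, Proc. Camb. Phil. Soc. 32 (1936) 477;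
G. Grimmett, Percolation (2nd ed.) §4.2 (animal counting); E. Seiler, LNP 159 (1982) Ch. 3.
-/

set_option autoImplicit false

noncomputable section

open MeasureTheory
open Literature.MathematicalPhysics.QuantumFieldTheory hiding ZdEdge
open Literature.MathematicalPhysics.QuantumLattice
open Literature.Probability.LatticeModels (Site)
open Summit.QuantumFields.YangMills.Cruxes.IR.Tempered (cellEdges)
open Summit.QuantumFields.YangMills.Theorems.OddTorusChessboard (cellPlaqs plaqAction cellSites mem_cellSites
  plaqAction_congr plaqAction_one measurable_plaqAction plaquetteEdges_subset_of_mem_cellPlaqs)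

namespace Summit.QuantumFields.YangMills.Cruxes.IR.AfPincerUc.SharpLanes

open Summit.QuantumFields.YangMills.Cruxes.IR.AfPincerUc

/-! ## §1 The sharp touching count in `ℤ⁴`: an edge lies in exactly six plaquettes -/
section Touching

/-- **The star of an edge `(x, i)` of `ℤ⁴`**: the plaquettes in a plane `{i, j}`, `j ≠ i`, based at `x` or at `x − e_j` — the six
plaquettes having `(x, i)` among their four edges (the branch `j = i` is empty). -/
def edgeStar (e : ZdEdge 4) : Finset (ZdPlaquette 4) :=
  ((Finset.univ : Finset (Fin 4)).erase e.2).biUnion fun j =>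
    if hij : e.2 < j then {(e.1, ⟨(e.2, j), hij⟩), (e.1 - Pi.single j 1, ⟨(e.2, j), hij⟩)}
    else if hji : j < e.2 then {(e.1, ⟨(j, e.2), hji⟩), (e.1 - Pi.single j 1, ⟨(j, e.2), hji⟩)}
    else ∅

/-- The star of an edge has at most six plaquettes (three planes, two base points each). -/
theorem card_edgeStar_le (e : ZdEdge 4) : (edgeStar e).card ≤ 6 := by
  classical
  unfold edgeStar
  refine Finset.card_biUnion_le.trans ?_
  have hbr : ∀ j ∈ (Finset.univ : Finset (Fin 4)).erase e.2,
      (if hij : e.2 < j then ({(e.1, ⟨(e.2, j), hij⟩), (e.1 - Pi.single j 1, ⟨(e.2, j), hij⟩)} : Finset (ZdPlaquette 4))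
        else if hji : j < e.2 then {(e.1, ⟨(j, e.2), hji⟩), (e.1 - Pi.single j 1, ⟨(j, e.2), hji⟩)}
        else ∅).card ≤ 2 := by
    intro j _
    split_ifs
    · exact (Finset.card_insert_le _ _).trans (by rw [Finset.card_singleton])
    · exact (Finset.card_insert_le _ _).trans (by rw [Finset.card_singleton])
    · simp
  refine (Finset.sum_le_card_nsmul _ _ 2 hbr).trans ?_
  rw [Finset.card_erase_of_mem (Finset.mem_univ _), Finset.card_univ, Fintype.card_fin]
  decide

/-- Each of the four edges of a plaquette has the plaquette in its star. -/
theorem mem_edgeStar_of_mem_plaquetteEdges {p : ZdPlaquette 4} {e : ZdEdge 4} (he : e ∈ plaquetteEdges p) :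
    p ∈ edgeStar e := by
  classical
  obtain ⟨y, ⟨⟨a, b⟩, hab⟩⟩ := p
  have hab' : a < b := hab
  have hne : a ≠ b := ne_of_lt hab'
  simp only [plaquetteEdges, Finset.mem_insert, Finset.mem_singleton] at he
  unfold edgeStar
  rw [Finset.mem_biUnion]
  rcases he with rfl | rfl | rfl | rfl
  · refine ⟨b, Finset.mem_erase.2 ⟨hne.symm, Finset.mem_univ _⟩, ?_⟩
    rw [dif_pos hab']
    simp
  · refine ⟨a, Finset.mem_erase.2 ⟨hne, Finset.mem_univ _⟩, ?_⟩
    rw [dif_neg (lt_asymm hab'), dif_pos hab']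
    simp
  · refine ⟨b, Finset.mem_erase.2 ⟨hne.symm, Finset.mem_univ _⟩, ?_⟩
    rw [dif_pos hab']
    simp
  · refine ⟨a, Finset.mem_erase.2 ⟨hne, Finset.mem_univ _⟩, ?_⟩
    rw [dif_neg (lt_asymm hab'), dif_pos hab']
    simp

/-- The plaquettes touching a finite edge set lie in the union of the stars of its edges. -/
theorem plaquettesTouching_subset_biUnion_edgeStar (P : Finset (ZdEdge 4)) :
    plaquettesTouching P ⊆ P.biUnion edgeStar := by
  classical
  intro p hp
  obtain ⟨e, he⟩ := mem_plaquettesTouching_iff.1 hp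
  obtain ⟨hep, heP⟩ := Finset.mem_inter.1 he
  exact Finset.mem_biUnion.2 ⟨e, heP, mem_edgeStar_of_mem_plaquetteEdges hep⟩

/-- **Sharp touching count (PROVED)**: in `ℤ⁴` at most `6 · #P` plaquettes touch the edge set `P`. -/
theorem card_plaquettesTouching_le_six_mul (P : Finset (ZdEdge 4)) : (plaquettesTouching P).card ≤ 6 * P.card := by
  classical
  calc (plaquettesTouching P).card ≤ (P.biUnion edgeStar).card :=
        Finset.card_le_card (plaquettesTouching_subset_biUnion_edgeStar P)
    _ ≤ ∑ e ∈ P, (edgeStar e).card := Finset.card_biUnion_le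
    _ ≤ P.card • 6 := Finset.sum_le_card_nsmul _ _ 6 fun e _ => card_edgeStar_le e
    _ = 6 * P.card := by rw [smul_eq_mul, mul_comm]

end Touching

/-! ## §2 Bad clusters (walk form) among a plaquette set; the cluster-count class of a cell -/
section Clusters

variable {G : Type} [Group G] {N : ℕ} (ρ : G →* Matrix (Fin N) (Fin N) ℂ)

/-- **A `θ`-bad CLUSTER of more than `k` plaquettes among `Pl`** in the configuration `U`, walk form: plaquettes `c 0, …, c n ∈ Pl`
(`n ≤ 2k`, repetitions allowed), all `θ`-bad (`θ ≤ plaqAction ρ (c i) U`), consecutive base points within `ℓ∞`-distance `2`, visiting at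
least `k + 1` DISTINCT plaquettes.  (Depth-first traversal of a spanning tree turns every `2`-step-connected family of `k + 1` bad plaquettes
into such a walk and conversely the visited set of a walk is connected; the walk form carries the Peierls count `#B · 3750^n`.) -/
def HasBadClusterAmong (θ : ℝ) (Pl : Set (ZdPlaquette 4)) (k : ℕ) (U : LGConfig 4 G) : Prop :=
  ∃ (n : ℕ) (c : Fin (n + 1) → ZdPlaquette 4), n ≤ 2 * k ∧ (∀ i, c i ∈ Pl) ∧ (∀ i, θ ≤ plaqAction ρ (c i) U) ∧
    (∀ i : Fin n, supNormZ4 ((c i.castSucc).1 - (c i.succ).1) ≤ 2) ∧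
      k + 1 ≤ (Finset.univ.image c).card

/-- **`TypCluster` — the CLUSTER-COUNT class of the cell `c` of the frame `w`**: NO `θ`-bad cluster of more than `k` plaquettes among
the plaquettes fully inside the cell (`cellPlaqs w c`), at ANY scale or depth.  Configurations with any number of small bad clusters
(`≤ k` plaquettes each, pairwise more than `2` apart) belong to it. -/
def TypCluster (θ : ℝ) (w : Fin 4 → ℤ → ℤ) (k : ℕ) (c : Fin 4 → ℤ) : Set (LGConfig 4 G) :=
  {U | ¬ HasBadClusterAmong ρ θ (↑(cellPlaqs w c) : Set (ZdPlaquette 4)) k U}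

variable {ρ}

/-- Clusters are monotone in the threshold (downward). -/
theorem HasBadClusterAmong.mono {θ θ' : ℝ} {Pl : Set (ZdPlaquette 4)} {k : ℕ} {U : LGConfig 4 G}
    (h : HasBadClusterAmong ρ θ Pl k U) (hθ : θ' ≤ θ) : HasBadClusterAmong ρ θ' Pl k U := by
  obtain ⟨n, c, hn, hin, hbad, hstep, hcard⟩ := h
  exact ⟨n, c, hn, hin, fun i => hθ.trans (hbad i), hstep, hcard⟩

/-- Clusters are monotone in the ambient plaquette set. -/
theorem HasBadClusterAmong.mono_set {θ : ℝ} {Pl Pl' : Set (ZdPlaquette 4)} {k : ℕ} {U : LGConfig 4 G} (hPl : Pl ⊆ Pl')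
    (h : HasBadClusterAmong ρ θ Pl k U) : HasBadClusterAmong ρ θ Pl' k U := by
  obtain ⟨n, c, hn, hin, hbad, hstep, hcard⟩ := h
  exact ⟨n, c, hn, fun i => hPl (hin i), hbad, hstep, hcard⟩

/-- A cluster all of whose plaquettes have the same action in `U` and `V` transfers from `U` to `V`. -/
theorem HasBadClusterAmong.congr {θ : ℝ} {Pl : Set (ZdPlaquette 4)} {k : ℕ} {U V : LGConfig 4 G}
    (h : HasBadClusterAmong ρ θ Pl k U) (hUV : ∀ q ∈ Pl, plaqAction ρ q U = plaqAction ρ q V) :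
    HasBadClusterAmong ρ θ Pl k V := by
  obtain ⟨n, c, hn, hin, hbad, hstep, hcard⟩ := h
  exact ⟨n, c, hn, hin, fun i => by rw [← hUV _ (hin i)]; exact hbad i, hstep, hcard⟩

/-- **An injective `θ`-bad chain of `k + 1` plaquettes of `Pl` with `ℓ∞`-steps `≤ 2` is a bad cluster of more than `k` plaquettes**
(a walk of `k ≤ 2k` steps visiting `k + 1` distinct plaquettes). -/
theorem hasBadClusterAmong_of_injective {θ : ℝ} {Pl : Set (ZdPlaquette 4)} {k : ℕ} {U : LGConfig 4 G}
    (c : Fin (k + 1) → ZdPlaquette 4) (hinj : Function.Injective c) (hin : ∀ i, c i ∈ Pl)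
    (hbad : ∀ i, θ ≤ plaqAction ρ (c i) U) (hstep : ∀ i : Fin k, supNormZ4 ((c i.castSucc).1 - (c i.succ).1) ≤ 2) :
    HasBadClusterAmong ρ θ Pl k U := by
  classical
  refine ⟨k, c, by omega, hin, hbad, hstep, ?_⟩
  rw [Finset.card_image_of_injective _ hinj, Finset.card_univ, Fintype.card_fin]

/-- `TypCluster` is monotone in the badness threshold. -/
theorem typCluster_mono {θ θ' : ℝ} {w : Fin 4 → ℤ → ℤ} {k : ℕ} {c : Fin 4 → ℤ} (hθ : θ ≤ θ') :
    TypCluster ρ θ w k c ⊆ TypCluster ρ θ' w k c := fun _ hU h => hU (h.mono hθ)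

/-- Data all of whose own plaquettes are `θ`-good lie in the cluster class (every cluster walk starts at a bad plaquette). -/
theorem mem_typCluster_of_forall_lt {θ : ℝ} {w : Fin 4 → ℤ → ℤ} {k : ℕ} {c : Fin 4 → ℤ} {σ : LGConfig 4 G}
    (h : ∀ p ∈ cellPlaqs w c, plaqAction ρ p σ < θ) : σ ∈ TypCluster ρ θ w k c := by
  rintro ⟨n, ch, -, hin, hbad, -, -⟩
  exact absurd (hbad 0) (not_le.2 (h _ (Finset.mem_coe.1 (hin 0))))

/-- Calibration: the trivial configuration has no bad plaquette at all for `θ > 0`, hence lies in every `TypCluster`. -/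
theorem one_mem_typCluster {θ : ℝ} (hθ : 0 < θ) (w : Fin 4 → ℤ → ℤ) (k : ℕ) (c : Fin 4 → ℤ) :
    (1 : LGConfig 4 G) ∈ TypCluster ρ θ w k c :=
  mem_typCluster_of_forall_lt fun p _ => by rw [plaqAction_one]; exact hθ

/-- **What the class excludes, by format (PROVED)**: a configuration carrying an INJECTIVE `θ`-bad chain of `k + 1` own plaquettes
with `ℓ∞`-steps `≤ 2` — a wall line, a film or a rough patch threading `k + 1` bad plaquettes, WHATEVER ITS EXTENT OR DEPTH — is not in
`TypCluster ρ θ w k c`. -/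
theorem not_mem_typCluster_of_injective {θ : ℝ} {w : Fin 4 → ℤ → ℤ} {k : ℕ} {c₀ : Fin 4 → ℤ} {U : LGConfig 4 G}
    (c : Fin (k + 1) → ZdPlaquette 4) (hinj : Function.Injective c) (hin : ∀ i, c i ∈ cellPlaqs w c₀)
    (hbad : ∀ i, θ ≤ plaqAction ρ (c i) U) (hstep : ∀ i : Fin k, supNormZ4 ((c i.castSucc).1 - (c i.succ).1) ≤ 2) :
    U ∉ TypCluster ρ θ w k c₀ :=
  fun hU => hU (hasBadClusterAmong_of_injective c hinj (fun i => Finset.mem_coe.2 (hin i)) hbad hstep)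

/-! ## §3 `TypCluster ⊆ TypChain`: a long bad chain contains a cluster of more than `k` plaquettes -/

/-- **A `θ`-bad chain of extent `≥ ℓ₀` among `Pl` yields a bad cluster of more than `k` plaquettes among `Pl`, as soon as `2k ≤ ℓ₀ + 1`**
(loop erasure `exists_injective_chain`: an injective sub-chain of `K + 1` plaquettes with `ℓ₀ ≤ 2K`, so `k ≤ K`; its first `k + 1` plaquettes). -/
theorem hasBadClusterAmong_of_hasBadChainAmong {θ : ℝ} {Pl : Set (ZdPlaquette 4)} {k ℓ₀ : ℕ} (hkℓ : 2 * k ≤ ℓ₀ + 1)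
    {U : LGConfig 4 G} (h : HasBadChainAmong ρ θ Pl ℓ₀ U) : HasBadClusterAmong ρ θ Pl k U := by
  classical
  obtain ⟨m, ch, hin, hbad, hstep, hext⟩ := h
  obtain ⟨K, c', hinj, hQ, hstep', hD⟩ := exists_injective_chain
    (Q := fun p => p ∈ Pl ∧ θ ≤ plaqAction ρ p U) ch (fun i => ⟨hin i, hbad i⟩) hstep hext
  have hkK : k + 1 ≤ K + 1 := by omega
  refine hasBadClusterAmong_of_injective (fun i => c' (Fin.castLE hkK i))
    (hinj.comp (Fin.castLE_injective hkK)) (fun i => (hQ _).1) (fun i => (hQ _).2) fun i => ?_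
  have hi : i.val < K := by omega
  have e1 : Fin.castLE hkK i.castSucc = (⟨i.val, hi⟩ : Fin K).castSucc := Fin.ext rfl
  have e2 : Fin.castLE hkK i.succ = (⟨i.val, hi⟩ : Fin K).succ := Fin.ext (by simp)
  simp only [e1, e2]
  exact hstep' ⟨i.val, hi⟩

/-- **`TypCluster ⊆ TypChain` (PROVED)**: for `2k ≤ ℓ₀ + 1`, `TypCluster ρ θ w k c ⊆ TypChain ρ θ w ℓ₀ c` — the count class is the
SMALLER class (so clause (i) for it is implied by clause (i) for the class of record, `clauseIAll_typCluster_of_typChain`). -/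
theorem typCluster_subset_typChain {θ : ℝ} (w : Fin 4 → ℤ → ℤ) {k ℓ₀ : ℕ} (hkℓ : 2 * k ≤ ℓ₀ + 1) (c : Fin 4 → ℤ) :
    TypCluster ρ θ w k c ⊆ TypChain ρ θ w ℓ₀ c :=
  fun _ hU h => hU (hasBadClusterAmong_of_hasBadChainAmong hkℓ h)

/-- Hence `TypCluster ⊆ TypChainDeep` at every depth (`typChain_subset_typChainDeep`). -/
theorem typCluster_subset_typChainDeep {θ : ℝ} (w : Fin 4 → ℤ → ℤ) {k ℓ₀ : ℕ} (hkℓ : 2 * k ≤ ℓ₀ + 1) (D : ℕ) (c : Fin 4 → ℤ) :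
    TypCluster ρ θ w k c ⊆ TypChainDeep ρ θ w ℓ₀ D c := (typCluster_subset_typChain w hkℓ c).trans (typChain_subset_typChainDeep θ w ℓ₀ D c)

variable [TopologicalSpace G] [IsTopologicalGroup G] [CompactSpace G] [MeasurableSpace G] [BorelSpace G]

/-- Clause (i) at every centre is ANTITONE in the class: a pointwise smaller family has fewer exterior pairs to control. -/
theorem clauseIAll_anti_typ {β : ℝ} {w : Fin 4 → ℤ → ℤ} {n : ℕ} {ε : ℝ} {Typ Typ' : (Fin 4 → ℤ) → Set (LGConfig 4 G)}
    (hsub : ∀ c, Typ c ⊆ Typ' c) (hI : ClauseIAll ρ β w n ε Typ') : ClauseIAll ρ β w n ε Typ :=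
  fun c₀ Y hYw h0 σ σ' htyp hagree f hf hfm hf01 =>
    hI c₀ Y hYw h0 σ σ' (fun c hc hcY => ⟨hsub (c + c₀) (htyp c hc hcY).1, hsub (c + c₀) (htyp c hc hcY).2⟩)
      hagree f hf hfm hf01

/-- **Clause (i) for `TypCluster ρ θ w k` is IMPLIED by clause (i) for the class of record `TypChain ρ θ w ℓ₀`, `2k ≤ ℓ₀ + 1` (PROVED).** -/
theorem clauseIAll_typCluster_of_typChain {β : ℝ} {w : Fin 4 → ℤ → ℤ} {n : ℕ} {ε θ : ℝ} {k ℓ₀ : ℕ} (hkℓ : 2 * k ≤ ℓ₀ + 1)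
    (hI : ClauseIAll ρ β w n ε (TypChain ρ θ w ℓ₀)) : ClauseIAll ρ β w n ε (TypCluster ρ θ w k) :=
  clauseIAll_anti_typ (fun c => typCluster_subset_typChain w hkℓ c) hI

end Clusters

/-! ## §4 Cell-locality and measurability (`TypLocal`), for every plaquette sub-family of the cell -/
section Locality

variable {G : Type} [Group G] {N : ℕ} (ρ : G →* Matrix (Fin N) (Fin N) ℂ)

/-- **The cluster class over a sub-family of the cell's plaquettes is cell-local**: membership is read off the cell's own edges. -/
theorem noClusterAmong_dependsOn (θ : ℝ) {w : Fin 4 → ℤ → ℤ} {c : Fin 4 → ℤ} {Pl : Set (ZdPlaquette 4)}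
    (hPl : Pl ⊆ ↑(cellPlaqs w c)) (k : ℕ) :
    DependsOn (fun σ : LGConfig 4 G => σ ∈ {U | ¬ HasBadClusterAmong ρ θ Pl k U}) ↑(cellEdges w c) := by
  intro U V hUV
  have hq : ∀ q ∈ Pl, plaqAction ρ q U = plaqAction ρ q V := by
    intro q hq
    exact plaqAction_congr ρ q fun e he =>
      hUV e (Finset.mem_coe.2 (plaquetteEdges_subset_of_mem_cellPlaqs (Finset.mem_coe.1 (hPl hq)) he))
  simp only [Set.mem_setOf_eq]
  exact propext ⟨fun hU hV => hU (hV.congr fun q hq' => (hq q hq').symm), fun hV hU => hV (hU.congr hq)⟩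

/-- `TypCluster` is cell-local. -/
theorem typCluster_dependsOn (θ : ℝ) (w : Fin 4 → ℤ → ℤ) (k : ℕ) (c : Fin 4 → ℤ) :
    DependsOn (fun σ : LGConfig 4 G => σ ∈ TypCluster ρ θ w k c) ↑(cellEdges w c) :=
  noClusterAmong_dependsOn ρ θ subset_rfl k

variable [TopologicalSpace G] [IsTopologicalGroup G] [MeasurableSpace G] [BorelSpace G] [SecondCountableTopology G]

/-- **The cluster class over ANY plaquette set is measurable** (for continuous `ρ`): its complement is a countable union, over walk
shapes, of finite intersections of the closed events `θ ≤ plaqAction ρ q ·`. -/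
theorem measurableSet_noClusterAmong (hρ : Continuous ρ) (θ : ℝ) (Pl : Set (ZdPlaquette 4)) (k : ℕ) :
    MeasurableSet {U : LGConfig 4 G | ¬ HasBadClusterAmong ρ θ Pl k U} := by
  classical
  have hrepr : {U : LGConfig 4 G | ¬ HasBadClusterAmong ρ θ Pl k U} =
      (⋃ (n : ℕ), ⋃ (ch : Fin (n + 1) → ZdPlaquette 4),
        {U : LGConfig 4 G | n ≤ 2 * k ∧ (∀ i, ch i ∈ Pl) ∧ (∀ i, θ ≤ plaqAction ρ (ch i) U) ∧
          (∀ i : Fin n, supNormZ4 ((ch i.castSucc).1 - (ch i.succ).1) ≤ 2) ∧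
            k + 1 ≤ (Finset.univ.image ch).card})ᶜ := by
    ext U
    simp only [HasBadClusterAmong, Set.mem_setOf_eq, Set.mem_compl_iff, Set.mem_iUnion, not_exists]
  rw [hrepr]
  refine MeasurableSet.compl (MeasurableSet.iUnion fun n => MeasurableSet.iUnion fun ch => ?_)
  by_cases hA : n ≤ 2 * k ∧ (∀ i, ch i ∈ Pl) ∧
      (∀ i : Fin n, supNormZ4 ((ch i.castSucc).1 - (ch i.succ).1) ≤ 2) ∧ k + 1 ≤ (Finset.univ.image ch).card
  · have hset : {U : LGConfig 4 G | n ≤ 2 * k ∧ (∀ i, ch i ∈ Pl) ∧ (∀ i, θ ≤ plaqAction ρ (ch i) U) ∧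
        (∀ i : Fin n, supNormZ4 ((ch i.castSucc).1 - (ch i.succ).1) ≤ 2) ∧
          k + 1 ≤ (Finset.univ.image ch).card} = ⋂ i, {U | θ ≤ plaqAction ρ (ch i) U} := by
      ext U
      simp [hA]
    rw [hset]
    exact MeasurableSet.iInter fun i => measurableSet_le measurable_const (measurable_plaqAction ρ hρ _)
  · have hset : {U : LGConfig 4 G | n ≤ 2 * k ∧ (∀ i, ch i ∈ Pl) ∧ (∀ i, θ ≤ plaqAction ρ (ch i) U) ∧
        (∀ i : Fin n, supNormZ4 ((ch i.castSucc).1 - (ch i.succ).1) ≤ 2) ∧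
          k + 1 ≤ (Finset.univ.image ch).card} = ∅ := by
      ext U
      simp only [Set.mem_setOf_eq, Set.mem_empty_iff_false, iff_false]
      rintro ⟨h1, h2, -, h4, h5⟩
      exact hA ⟨h1, h2, h4, h5⟩
    rw [hset]
    exact MeasurableSet.empty

/-- `TypCluster` is measurable (continuous `ρ`). -/
theorem measurableSet_typCluster (hρ : Continuous ρ) (θ : ℝ) (w : Fin 4 → ℤ → ℤ) (k : ℕ) (c : Fin 4 → ℤ) :
    MeasurableSet (TypCluster ρ θ w k c) :=
  measurableSet_noClusterAmong ρ hρ θ _ k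

/-- **`TypCluster` is a `TypLocal` family** (the format's bookkeeping conjuncts), for continuous `ρ`. -/
theorem typLocal_typCluster (hρ : Continuous ρ) (θ : ℝ) (w : Fin 4 → ℤ → ℤ) (k : ℕ) :
    TypLocal w (TypCluster ρ θ w k) :=
  ⟨fun c => measurableSet_typCluster ρ hρ θ w k c, fun c => typCluster_dependsOn ρ θ w k c⟩

end Locality

/-! ## §5 R109 (3) for the cluster class: insertion tolerance, own-plaquette guard, sharp count `6ℓ₁ ≤ k` -/
section Tolerance

variable {G : Type} [Group G] {N : ℕ} {ρ : G →* Matrix (Fin N) (Fin N) ℂ}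

/-- **R109 (3), own-plaquette guard, for the cluster class over ANY sub-family `Pl c ⊆ cellPlaqs w c` (PROVED).**  For `θg < θb`,
`R ≥ 3` and `6ℓ₁ ≤ k` the family `c ↦ {U | no θb-bad cluster of more than k plaquettes among Pl c}` is `(θg, R, ℓ₁)`-insertion tolerant
with the OWN guard: a walk plaquette off `P` keeps its `U`-action, so it is `θb`-bad in `U` and cannot sit in the `θg`-clean guard, where a
walk neighbour touching `P` would put it (`mem_guard_of_near_touching`); so the walk is all-off `P` (a cluster of `U`) or all-on `P` (`≤ 6 #P ≤ k`). -/
theorem insertionTolerantOwn_noClusterAmong {θg θb : ℝ} (hθ : θg < θb) (w : Fin 4 → ℤ → ℤ) {R k ℓ₁ : ℕ}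
    (hR : 3 ≤ R) (hℓ : 6 * ℓ₁ ≤ k) {Pl : (Fin 4 → ℤ) → Finset (ZdPlaquette 4)}
    (hPl : ∀ c, Pl c ⊆ cellPlaqs w c) :
    InsertionTolerantOwn ρ w θg R ℓ₁ (fun c => {U | ¬ HasBadClusterAmong ρ θb (↑(Pl c) : Set (ZdPlaquette 4)) k U}) := by
  classical
  intro c U hU P _hPc hPm hclean V hVU
  rintro ⟨n, q, hn, hqin, hqbad, hqstep, hqcard⟩
  have hin' : ∀ i, q i ∈ cellPlaqs w c := fun i => hPl c (Finset.mem_coe.1 (hqin i))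
  -- (1) a walk plaquette off `P` is `θb`-bad in `U`
  have hbadU : ∀ i, ¬ (plaquetteEdges (q i) ∩ P).Nonempty → θb ≤ plaqAction ρ (q i) U := by
    intro i hi
    have h := hqbad i
    rwa [plaqAction_eq_of_not_touching ρ hVU hi] at h
  -- (2) no mixed pair at walk distance
  have hmix : ∀ i j : Fin (n + 1), supNormZ4 ((q i).1 - (q j).1) ≤ 2 →
      (plaquetteEdges (q i) ∩ P).Nonempty → (plaquetteEdges (q j) ∩ P).Nonempty := by
    intro i j hij hi
    by_contra hj
    have hmem := mem_guard_of_near_touching (R := R) hR hi (hin' j) hij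
    have h1 := hclean _ (hin' j) hmem
    have h2 := hbadU j hj
    linarith
  -- (3) all-or-none along the walk
  have hprop : ∀ m (hm : m < n + 1),
      ((plaquetteEdges (q 0) ∩ P).Nonempty ↔ (plaquetteEdges (q ⟨m, hm⟩) ∩ P).Nonempty) := by
    intro m
    induction m with
    | zero => intro hm; exact Iff.rfl
    | succ m ih =>
      intro hm
      rw [ih (by omega)]
      have hs := hqstep ⟨m, by omega⟩
      exact ⟨hmix ⟨m, by omega⟩ ⟨m + 1, hm⟩ hs,
        hmix ⟨m + 1, hm⟩ ⟨m, by omega⟩ (by rw [supNormZ4_sub_comm]; exact hs)⟩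
  by_cases h0 : (plaquetteEdges (q 0) ∩ P).Nonempty
  · -- ALL ON `P`: the walk visits at most `6 #P ≤ 6 ℓ₁ ≤ k` plaquettes
    have hall : ∀ i, (plaquetteEdges (q i) ∩ P).Nonempty := fun i => (hprop i.1 i.2).1 h0
    have hsub : Finset.univ.image q ⊆ plaquettesTouching P := by
      intro p hp
      obtain ⟨i, -, rfl⟩ := Finset.mem_image.1 hp
      exact mem_plaquettesTouching_iff.2 (hall i)
    have h1 := Finset.card_le_card hsub
    have h2 := card_plaquettesTouching_le_six_mul P
    have h3 : 6 * P.card ≤ 6 * ℓ₁ := Nat.mul_le_mul_left _ hPm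
    omega
  · -- ALL OFF `P`: the walk was already a cluster of `U`
    have hnone : ∀ i, ¬ (plaquetteEdges (q i) ∩ P).Nonempty := fun i hi => h0 ((hprop i.1 i.2).2 hi)
    exact hU ⟨n, q, hn, hqin, fun i => hbadU i (hnone i), hqstep, hqcard⟩

/-- **R109 (3) for `TypCluster`, own-plaquette guard (PROVED)**: `θg < θb`, `R ≥ 3`, `6ℓ₁ ≤ k`. -/
theorem insertionTolerantOwn_typCluster {θg θb : ℝ} (hθ : θg < θb) (w : Fin 4 → ℤ → ℤ) {R k ℓ₁ : ℕ} (hR : 3 ≤ R)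
    (hℓ : 6 * ℓ₁ ≤ k) : InsertionTolerantOwn ρ w θg R ℓ₁ (TypCluster ρ θb w k) :=
  insertionTolerantOwn_noClusterAmong hθ w hR hℓ fun _ => subset_rfl

/-- **R109 (3) for `TypCluster` in the reading of record `InsertionTolerant` (PROVED)** — from the own-guard form. -/
theorem insertionTolerant_typCluster {θg θb : ℝ} (hθ : θg < θb) (w : Fin 4 → ℤ → ℤ) {R k ℓ₁ : ℕ} (hR : 3 ≤ R)
    (hℓ : 6 * ℓ₁ ≤ k) : InsertionTolerant ρ w θg R ℓ₁ (TypCluster ρ θb w k) :=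
  InsertionTolerant.of_own (insertionTolerantOwn_typCluster hθ w hR hℓ)

/-- **Constants of record (R109 (4)) for the cluster class**: `ℓ₁ = 6` tolerated insertions, radius `R = 3`, any count `k ≥ 36`, every
`θg < θb`. -/
theorem insertionTolerant_typCluster_record {θg θb : ℝ} (hθ : θg < θb) (w : Fin 4 → ℤ → ℤ) {k : ℕ} (hk : 36 ≤ k) :
    InsertionTolerant ρ w θg 3 6 (TypCluster ρ θb w k) :=
  insertionTolerant_typCluster hθ w le_rfl (by omega)

end Tolerance

end Summit.QuantumFields.YangMills.Cruxes.IR.AfPincerUc.SharpLanes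

end
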